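import Literature.MathematicalPhysics.QuantumFieldTheory.Balaban1983to89.B9Eq310HessianOperator

/-!
# `Balaban1983to89.B9Eq310HessianHermitian` — T. Bałaban, *Propagators for lattice gauge theories in a background field*, Commun. Math. Phys.
# **99** (1985) 389–434 [Balaban1985BackgroundPropagators] (3.10) p. 392: *«For U with values in the unitary group U(N) it is a hermitian
# operator»* — the curvature operator `Δ′` (and with it the Hessian `Δ = D*D + Δ′`) of `B9Eq310HessianOperator` IS SYMMETRIC on the `L²` space of
# `𝔤ᶜ`-valued bond functions when the background is UNITARY (`U(b)* = U(b)⁻¹`) and the trace datum is a genuine trace (`τ(X*) = conj τ(X)`,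
# `τ(XY) = τ(YX)`), PROVED from the star-algebra of the plaquette holonomy

statement-level skeleton of published theorems with citation tags; proofs where landed; nothing here is a claim
about the Yang–Mills mass gap

PDF held: `paper:balaban1985-cmp99-background-propagators` (journal page = PDF page + 388), p. 392 read by this seat (2026-08-21) on the render
`pub-balaban/b2b-balaban-ref1/pages/1985-cmp99-background-propagators/…-p004-x2.png`; the verbatim text of (3.10) is quoted in `B9Eq310DeltaPrime`.

THE PRINT (verbatim, p. 392).  *«We denote it by Δ^η(U), or simply by Δ. For U with values in the unitary group U(N) it is a hermitian operator given by
the quadratic form ⟨A, ΔA⟩ = ⟨A, D*DA⟩ + ⟨A, Δ′A⟩ … (3.10)»*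

WHY THIS FILE (cell context).  `B9Eq310HessianOperator` (pub-balaban NE9 owner, gen 77) constructed `Δ′` as the operator `curvOp φ τ η U` of the
sesquilinear reading `(f, g) ↦ curvForm τ η U (Φf)* (Φg)` of the printed quadratic form and left its HERMITICITY displayed (*«(M2) … its
HERMITICITY for unitary U … NOT proved here»*; the consumer letter is `hΔ : Δ₁.IsSymmetric` of `B11Eq103H1Complex.laplaceALatticeK_isSymmetric`).
This file PROVES it from three structural facts about the model: the background is unitary, `star (U b) = (U b)⁻¹`; the trace datum is a
`*`-trace, `τ (star X) = conj (τ X)` and `τ (X * Y) = τ (Y * X)`.  Then the holonomy satisfies `U(∂p)* = U(∂p)⁻¹`, its complexified real and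
imaginary parts are self-adjoint, `star` commutes with the transporters `R(U(b))`, the edge variables and the curl, and the two blocks of
(3.10) are hermitian forms — so `Δ′` is a symmetric operator, and `Δ = D*D + Δ′` is symmetric once the transporters read on the Hilbert fibre are
mutually adjoint (`B9Eq310HessianOperator.principalOpK_isSymmetric`).

WHAT IS PROVED (sorry-free; no `Prop` placeholder; no inequality of the paper).
* §1 `star_val_inv_of_unitary`, **`star_plaqHolU`** (`U(∂p)* = U(∂p)⁻¹`), **`star_reHol`**, **`star_imHol`** (self-adjoint real/imaginary parts).
* §2 **`star_adTransport`** (`(U X U⁻¹)* = U X* U⁻¹`), `star_edgeLin`, **`star_curlAt`** (for a real scalar `c`).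
* §3 `conj_trace_mul_mul`, `conj_trace_comm_mul` (the two `*`-trace identities), **`curvBlock₁_star_symm`**, **`curvBlock₂_star_symm`**,
  **`curvForm_star_symm`**: `curvForm τ η U (star Y) X = conj (curvForm τ η U (star X) Y)` — the polarized (3.10) is a HERMITIAN form.
* §4 **`curvOp_isSymmetric`** — `Δ′` IS SYMMETRIC (*«hermitian operator»*); **`hessOp_isSymmetric`** — `Δ = D*D + Δ′` is symmetric under, in
  addition, the adjointness of the transporters read on the Hilbert fibre; **`adTransportW_adjoint`** DERIVES that adjointness from the compatibility
  `⟨φ⁻¹X, φ⁻¹Y⟩ = τ(X*Y)` of the two normings ([B7] (18)), whence **`hessOp_isSymmetric_of_trace`** (no adjointness letter displayed).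
MODEL / DECLARED READINGS.  (M1) as `B9Eq310HessianOperator`.  (M2) the three structural hypotheses are DISPLAYED (they hold for `𝔸 = M_N(ℂ)`, `τ` the
normalized trace, `U(b) ∈ U(N)`; not instantiated here).  (M3) NOT HERE: positivity / bounds of `Δ`, `Δ′` ([B9] Thm 3.11).
HONEST SCOPE.  [folklore] star-algebra on the cell's own objects proving ONE printed structural sentence («hermitian operator»); no estimate; NOT
summit progress (cell pub-balaban: NE9 NOT PRINTED / NOT PROVED; spine PROVED 0/9).  Filed by the pub-balaban NE9 BINDER-row owner lineage
`b2b-balaban-t4-ne9-p1` (gen 77); NEW file importing `B9Eq310HessianOperator` only; nothing modified.  Net new unproved facts: 0.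
-/

noncomputable section

open scoped InnerProductSpace ComplexConjugate BigOperators

namespace Literature.MathematicalPhysics.QuantumFieldTheory.Balaban1983to89.B9Eq310HessianHermitian

open B9SectCLatticeCarrier (Bond Plaq DirPair shift)
open B4Sect5Torus (TSite)
open B9Eq33CovDerivVector (adTransport adTransport_apply)
open B9Eq310DeltaPrime
open B9Eq310HessianOperator
open B11Eq103H1Complex (BondL2K)

variable {d : ℕ} {Pd : Fin d → ℕ} {𝔸 : Type*} [Ring 𝔸] [StarRing 𝔸] [Algebra ℂ 𝔸] [StarModule ℂ 𝔸]

/-! ## §1 Unitary backgrounds: `U(b)* = U(b)⁻¹`, `U(∂p)* = U(∂p)⁻¹`, self-adjoint `Re`/`Im` -/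

section Holonomy

variable {U : Bond d Pd → 𝔸ˣ} (hU : ∀ b, star (U b : 𝔸) = ((U b)⁻¹ : 𝔸ˣ))
include hU

omit [Algebra ℂ 𝔸] [StarModule ℂ 𝔸] in
/-- For a unitary background also `(U(b)⁻¹)* = U(b)`. [cite: Balaban1985BackgroundPropagators, (3.5) p.391] -/
theorem star_val_inv_of_unitary (b : Bond d Pd) : star (((U b)⁻¹ : 𝔸ˣ) : 𝔸) = (U b : 𝔸) := by
  rw [← hU b, star_star]

omit [Algebra ℂ 𝔸] [StarModule ℂ 𝔸] in
/-- **`U(∂p)* = U(∂p)⁻¹`** for a unitary background (the holonomy of a product of unitaries is unitary). [cite: Balaban1985BackgroundPropagators, (3.1) p.390, (3.7) p.391] -/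
theorem star_plaqHolU (p : Plaq d Pd) : star (plaqHolU U p : 𝔸) = ((plaqHolU U p)⁻¹ : 𝔸ˣ) := by
  simp only [plaqHolU, Units.val_mul, mul_inv_rev, star_mul, hU, star_val_inv_of_unitary hU, inv_inv, mul_assoc]

omit [Algebra ℂ 𝔸] [StarModule ℂ 𝔸] in
/-- `(U(∂p)⁻¹)* = U(∂p)`. [cite: Balaban1985BackgroundPropagators, (3.7) p.391] -/
theorem star_plaqHolU_inv (p : Plaq d Pd) : star (((plaqHolU U p)⁻¹ : 𝔸ˣ) : 𝔸) = (plaqHolU U p : 𝔸) := by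
  rw [← star_plaqHolU hU p, star_star]

/-- **`(Re U(∂p))* = Re U(∂p)`** for a unitary background. [cite: Balaban1985BackgroundPropagators, (3.7) p.391] -/
theorem star_reHol (p : Plaq d Pd) : star (reHol U p) = reHol U p := by
  rw [reHol, star_smul, star_add, star_plaqHolU hU, star_plaqHolU_inv hU, add_comm]
  norm_num

/-- **`(Im U(∂p))* = Im U(∂p)`** for a unitary background (`(1/2i)(U − U⁻¹)` is self-adjoint). [cite: Balaban1985BackgroundPropagators, (3.7) p.391] -/
theorem star_imHol (p : Plaq d Pd) : star (imHol U p) = imHol U p := by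
  rw [imHol, star_smul, star_sub, star_plaqHolU hU, star_plaqHolU_inv hU]
  have h2 : star (-Complex.I / 2) = Complex.I / 2 := by
    rw [Complex.star_def, map_div₀, map_neg, Complex.conj_I, neg_neg, map_ofNat]
  rw [h2, ← neg_sub ((plaqHolU U p : 𝔸ˣ) : 𝔸) _, smul_neg, ← neg_smul, neg_div]

end Holonomy

/-! ## §2 `star` commutes with the transporters, the edge variables and the curl -/

section Transport

variable {U : Bond d Pd → 𝔸ˣ} (hU : ∀ b, star (U b : 𝔸) = ((U b)⁻¹ : 𝔸ˣ))
include hU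

omit [StarModule ℂ 𝔸] in
/-- **`(U X U⁻¹)* = U X* U⁻¹`** for unitary `U`: `star` commutes with `R(U(b))`. [cite: Balaban1985BackgroundPropagators, p.390] -/
theorem star_adTransport (b : Bond d Pd) (X : 𝔸) : star (adTransport (𝕜 := ℂ) U b X) = adTransport (𝕜 := ℂ) U b (star X) := by
  rw [adTransport_apply (𝕜 := ℂ), adTransport_apply (𝕜 := ℂ), star_mul, star_mul, hU, star_val_inv_of_unitary hU, mul_assoc]

omit [StarModule ℂ 𝔸] in
/-- `star` commutes with the four transported edge variables: `(A′(b))* = (A*)′(b)`. [cite: Balaban1985BackgroundPropagators, (3.2) p.390] -/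
theorem star_edgeLin (p : Plaq d Pd) (k : Fin 4) (A : Bond d Pd → 𝔸) : star (edgeLin U p k A) = edgeLin U p k (star A) := by
  obtain ⟨x, q⟩ := p
  fin_cases k
  · show star (edgeLin U (x, q) 0 A) = edgeLin U (x, q) 0 (star A)
    rw [edgeLin_zero, edgeLin_zero, star_neg, ← adTransport_apply (𝕜 := ℂ), ← adTransport_apply (𝕜 := ℂ), star_adTransport hU]
    rfl
  · show star (edgeLin U (x, q) 1 A) = edgeLin U (x, q) 1 (star A)
    rw [edgeLin_one, edgeLin_one, star_neg]
    rfl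
  · show star (edgeLin U (x, q) 2 A) = edgeLin U (x, q) 2 (star A)
    rw [edgeLin_two, edgeLin_two]
    rfl
  · show star (edgeLin U (x, q) 3 A) = edgeLin U (x, q) 3 (star A)
    rw [edgeLin_three, edgeLin_three, ← adTransport_apply (𝕜 := ℂ), ← adTransport_apply (𝕜 := ℂ), star_adTransport hU]
    rfl

/-- `star` commutes with the curl for a REAL scalar: `((D A)(p))* = (D A*)(p)`. [cite: Balaban1985BackgroundPropagators, (3.4) p.391] -/
theorem star_curlAt (η : ℝ) (p : Plaq d Pd) (A : Bond d Pd → 𝔸) :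
    star (curlAt ((η : ℂ))⁻¹ U p A) = curlAt ((η : ℂ))⁻¹ U p (star A) := by
  rw [curlAt_eq_smul_sum_edgeLin, curlAt_eq_smul_sum_edgeLin, star_smul, star_sum]
  congr 1
  · rw [star_inv₀, Complex.star_def, Complex.conj_ofReal]
  · exact Finset.sum_congr rfl fun k _ => star_edgeLin hU p k A

end Transport

/-! ## §3 The polarized (3.10) is a HERMITIAN form for a unitary background and a `*`-trace -/

section Form

variable (τ : 𝔸 →ₗ[ℂ] ℂ) (hτ₁ : ∀ X : 𝔸, τ (star X) = conj (τ X)) (hτ₂ : ∀ X Y : 𝔸, τ (X * Y) = τ (Y * X))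
include hτ₁ hτ₂

omit [StarModule ℂ 𝔸] in
/-- `*`-trace identity for the first block: `conj τ(a b M) = τ(b* a* M)` when `M* = M`. [cite: Balaban1985BackgroundPropagators, (3.10) p.392] -/
theorem conj_trace_mul_mul {a b M : 𝔸} (hM : star M = M) : conj (τ (a * b * M)) = τ (star b * star a * M) := by
  rw [← hτ₁, star_mul, star_mul, hM, ← mul_assoc, hτ₂ (M * star b) (star a), ← mul_assoc, hτ₂ (star a * M) (star b),
    ← mul_assoc]

omit [StarModule ℂ 𝔸] in
/-- `*`-trace identity for the commutator block: `conj τ((u v − v u) N) = −τ((u* v* − v* u*) N)` when `N* = N`.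
[cite: Balaban1985BackgroundPropagators, (3.10) p.392] -/
theorem conj_trace_comm_mul {u v N : 𝔸} (hN : star N = N) :
    conj (τ ((u * v - v * u) * N)) = -τ ((star u * star v - star v * star u) * N) := by
  rw [← hτ₁, star_mul, star_sub, star_mul, star_mul, hN, hτ₂ N, ← map_neg, ← neg_mul, neg_sub]


variable {U : Bond d Pd → 𝔸ˣ} (hU : ∀ b, star (U b : 𝔸) = ((U b)⁻¹ : 𝔸ˣ)) (η : ℝ)
include hU

/-- **The first block of (3.10) is a hermitian form**: `B₁((Y)*, X) = conj B₁((X)*, Y)`. [cite: Balaban1985BackgroundPropagators, (3.10) p.392] -/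
theorem curvBlock₁_star_symm (p : Plaq d Pd) (X Y : Bond d Pd → 𝔸) :
    curvBlock₁ τ η U p (star Y) X = conj (curvBlock₁ τ η U p (star X) Y) := by
  have hM : star (reHol U p - 1) = reHol U p - 1 := by rw [star_sub, star_reHol hU, star_one]
  rw [curvBlock₁_apply, curvBlock₁_apply, map_mul (starRingEnd ℂ), map_add (starRingEnd ℂ), conj_trace_mul_mul τ hτ₁ hτ₂ hM,
    conj_trace_mul_mul τ hτ₁ hτ₂ hM]
  simp only [star_curlAt hU, star_star]
  congr 1
  rw [map_div₀, map_one, map_ofNat]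

/-- **The commutator block of (3.10) is a hermitian form**: `B₂((Y)*, X) = conj B₂((X)*, Y)`. [cite: Balaban1985BackgroundPropagators, (3.10) p.392] -/
theorem curvBlock₂_star_symm (p : Plaq d Pd) (X Y : Bond d Pd → 𝔸) :
    curvBlock₂ τ η U p (star Y) X = conj (curvBlock₂ τ η U p (star X) Y) := by
  have hN : star ((((η : ℂ))⁻¹) ^ 2 • imHol U p) = (((η : ℂ))⁻¹) ^ 2 • imHol U p := by
    rw [star_smul, star_imHol hU, star_pow, star_inv₀, Complex.star_def, Complex.conj_ofReal]
  rw [curvBlock₂_apply, curvBlock₂_apply, map_sum]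
  refine Finset.sum_congr rfl fun kl _ => ?_
  rw [map_mul (starRingEnd ℂ), map_add (starRingEnd ℂ), conj_trace_comm_mul τ hτ₁ hτ₂ hN, conj_trace_comm_mul τ hτ₁ hτ₂ hN]
  simp only [star_edgeLin hU, star_star]
  rw [map_div₀, Complex.conj_I, map_ofNat]
  ring

/-- **THE POLARIZED (3.10) IS A HERMITIAN FORM**: `curvForm τ η U (Y*) X = conj (curvForm τ η U (X*) Y)` for a unitary background and a `*`-trace.
[cite: Balaban1985BackgroundPropagators, (3.10) p.392] -/
theorem curvForm_star_symm (X Y : Bond d Pd → 𝔸) : curvForm τ η U (star Y) X = conj (curvForm τ η U (star X) Y) := by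
  rw [curvForm_apply, curvForm_apply, map_sum]
  refine Finset.sum_congr rfl fun p _ => ?_
  rw [map_mul, map_pow, Complex.conj_ofReal, map_add, curvBlock₁_star_symm τ hτ₁ hτ₂ hU, curvBlock₂_star_symm τ hτ₁ hτ₂ hU]

end Form

/-! ## §4 «For U with values in the unitary group U(N) it is a hermitian operator» -/

section Operator

open B9Eq311L2Pairing (WL2)

variable {W : Type*} [NormedAddCommGroup W] [InnerProductSpace ℂ W] [FiniteDimensional ℂ W] (φ : W ≃ₗ[ℂ] 𝔸) {c₀ : ℝ} [Fact (0 < c₀)]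
  (τ : 𝔸 →ₗ[ℂ] ℂ) (hτ₁ : ∀ X : 𝔸, τ (star X) = conj (τ X)) (hτ₂ : ∀ X Y : 𝔸, τ (X * Y) = τ (Y * X)) (η : ℝ)
  {U : Bond d Pd → 𝔸ˣ} (hU : ∀ b, star (U b : 𝔸) = ((U b)⁻¹ : 𝔸ˣ))
include hτ₁ hτ₂ hU

/-- **`Δ′` IS A SYMMETRIC OPERATOR** on the `L²` space of `𝔤ᶜ`-valued bond functions for a unitary background and a `*`-trace — the curvature part of
*«it is a hermitian operator»*. [cite: Balaban1985BackgroundPropagators, (3.10) p.392] -/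
theorem curvOp_isSymmetric : (curvOp (c₀ := c₀) φ τ η U).IsSymmetric := by
  intro f g
  rw [← inner_conj_symm, inner_curvOp, inner_curvOp, ← curvForm_star_symm τ hτ₁ hτ₂ hU]

/-- **`Δ = D*D + Δ′` IS A SYMMETRIC OPERATOR** (unitary background, `*`-trace, transporters read on the Hilbert fibre mutually adjoint) — print's
*«For U with values in the unitary group U(N) it is a hermitian operator»*. [cite: Balaban1985BackgroundPropagators, (3.10) p.392] -/
theorem hessOp_isSymmetric
    (hRS : ∀ (b : Bond d Pd) (v u : W), ⟪adTransportW φ U b v, u⟫_ℂ = ⟪v, adTransportW φ (fun b => (U b)⁻¹) b u⟫_ℂ) :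
    (hessOp (c₀ := c₀) φ η U τ).IsSymmetric := by
  rw [hessOp]
  exact (principalOpK_isSymmetric φ η U hRS).add (curvOp_isSymmetric φ τ hτ₁ hτ₂ η hU)

omit [StarModule ℂ 𝔸] [FiniteDimensional ℂ W] hτ₁ in
/-- **The transporters read on the Hilbert fibre are mutually adjoint** — the `hRS` letter of `principalOpK_isSymmetric` DERIVED from the
compatibility `⟨φ⁻¹X, φ⁻¹Y⟩ = τ(X*Y)` ([B7] (18)), the unitarity of the background and the trace property: `⟨R(U(b))v, u⟩ = ⟨v, R(U(b)⁻¹)u⟩`.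
[cite: Balaban1985BackgroundPropagators, p.391; Balaban1985Averaging, (18) p.21] -/
theorem adTransportW_adjoint (hφ : ∀ X Y : 𝔸, ⟪φ.symm X, φ.symm Y⟫_ℂ = τ (star X * Y)) (b : Bond d Pd) (v u : W) :
    ⟪adTransportW φ U b v, u⟫_ℂ = ⟪v, adTransportW φ (fun b => (U b)⁻¹) b u⟫_ℂ := by
  rw [adTransportW_apply, adTransportW_apply, ← φ.symm_apply_apply v, ← φ.symm_apply_apply u, hφ, hφ]
  simp only [φ.apply_symm_apply]
  rw [star_mul, star_mul, hU, star_val_inv_of_unitary hU, inv_inv]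
  -- `τ (U · (v* · U⁻¹) · u) = τ (v* · (U⁻¹ · u · U))`
  rw [mul_assoc (U b : 𝔸) _ (φ u), hτ₂ (U b : 𝔸)]
  simp only [mul_assoc]

/-- **`Δ = D*D + Δ′` IS SYMMETRIC, all letters derived**: unitary background, `*`-trace, and the compatibility `⟨φ⁻¹X, φ⁻¹Y⟩ = τ(X*Y)` of the two
normings — print's *«hermitian operator»* with no adjointness letter left displayed. [cite: Balaban1985BackgroundPropagators, (3.10) p.392] -/
theorem hessOp_isSymmetric_of_trace (hφ : ∀ X Y : 𝔸, ⟪φ.symm X, φ.symm Y⟫_ℂ = τ (star X * Y)) :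
    (hessOp (c₀ := c₀) φ η U τ).IsSymmetric :=
  hessOp_isSymmetric φ τ hτ₁ hτ₂ η hU (adTransportW_adjoint φ τ hτ₂ hU hφ)

end Operator

end Literature.MathematicalPhysics.QuantumFieldTheory.Balaban1983to89.B9Eq310HessianHermitian

end
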